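import Literature.AlgebraicGeometry.Resolution.AffineBlowupUniversal
import Literature.AlgebraicGeometry.Resolution.BlowupsProduct
import HarnessLib

/-!
# The principal charts of a blowing up (intrinsic form of the charts `D₊(gt) = Spec A[I/g]`)

Topic: `Literature/AlgebraicGeometry/Resolution`. For a blowing up `π : X' → X` in the sense of
the universal property (`IsBlowup π I`, `Blowups.lean`; Görtz–Wedhorn I, Def. 13.90), an affine
open `U ⊆ X` and a section `g ∈ I(U)`, the **principal chart** `X'[U, g] ⊆ π⁻¹(U)` is the largest
open subset over `U` on which the pulled-back section `π^*g` is a regular generator of the inverse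
image ideal sheaf `I·𝒪_{X'}` (the ideal of the exceptional divisor). Under the comparison
isomorphism `π⁻¹(U) ≅ Bl_{I(U)}(Spec Γ(X, U)) = Proj ⨁ I(U)ⁿ` (uniqueness of blowing ups) it is
the standard chart `D₊(g t) = Spec A[I/g]` of Stacks, Tag 0804 ("`b⁻¹(U)` has an affine open
covering by spectra of the affine blowup algebras `A[I/a]`") and Tag 02OS (proof: the restriction
of `E` to it is cut out by the image of `a`, a nonzerodivisor), whence the charts are AFFINE, `I·𝒪_{X'}` is generated on
`X'[U, g]` by the nonzerodivisor `π^*g`, and the charts at a family of generators of `I(U)` cover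
`π⁻¹(U)`. All PROVED:

* `IsPrincipalChart π I U g W`, `blowupChart π I U g` — the definition (a supremum of affine
  opens; no blowing-up hypothesis needed) and its formal properties;
* `affineBlowup.ideal_exceptionalIdeal_chartOpen`, `affineBlowup.pull_mem_nonZeroDivisors` — on
  the chart `D₊(bt)` of `Bl_I(Spec R)` the exceptional ideal is generated by the (regular) image
  of `b` (explicit form of `affineBlowup.exceptionalIdeal_chartOpen`, `AffineBlowupCartier.lean`);
* `affineBlowup.exists_lift_preimage_basicOpen_eq_top` — a morphism `T → Spec R` along which
  `I·Γ(T, 𝒪_T)` is generated by the regular image of `b ∈ I` lifts INTO the chart `D₊(bt)`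
  (Görtz–Wedhorn I, proof of Prop. 13.92, p. 415);
* `affineBlowup.iSup_chartOpen_eq_top` — the charts at generators of `I` cover `Bl_I(Spec R)`;
* `IsBlowup.comap_fromSpec`, `IsBlowup.restrict_isoSpec`, `IsBlowup.exists_chartImmersion` — the
  open immersion `Bl_{I(U)}(Spec Γ(X, U)) → X'` onto `π⁻¹(U)` over `U`;
* `IsBlowup.blowupChart_eq_image` — **the principal chart is the image of `D₊(gt)`**; hence
  `IsBlowup.isAffineOpen_blowupChart`, `IsBlowup.isPrincipalChart_blowupChart` (affine; `π^*g` is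
  a regular generator of `I·𝒪_{X'}` on it) and `IsBlowup.iSup_blowupChart` (the charts at
  generators of `I(U)` cover `π⁻¹(U)`).

These charts carry the relatively ample invertible sheaf `I·𝒪_{X'} = 𝒪_{X'}(1)` of the blowing
up in chart form; they are used in `BlowupGeneratingSections.lean` to prove that blowing ups of
projective schemes are projective (Hartshorne II, Prop. 7.16 (c)).

## Sources

* The Stacks Project, Tag 0804 (affine blowup algebras, the charts of the blowing up),
  Tag 02OS (= Lemma 31.33.4; its proof: on `Spec A[I/a]` one has `IA' = aA'` with `a` a
  nonzerodivisor, by Algebra Lemma 10.70.2 = Tag 07Z3), Tag 0806 (universal property) — tag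
  texts fetched and checked 2026-08-14. [StacksProject]
* U. Görtz, T. Wedhorn, *Algebraic Geometry I*, 2nd ed. (2020), (13.19), Def. 13.90,
  Prop. 13.91, Prop. 13.92 and its proof (p. 415). [GortzWedhorn2020]
* R. Hartshorne, *Algebraic Geometry*, GTM 52 (1977), II §7, proof of Prop. 7.10 (b) and
  Prop. 7.16 (c) (p. 161, 166). [Hartshorne1977]
-/

noncomputable section

open CategoryTheory CategoryTheory.Limits AlgebraicGeometry TopologicalSpace Opposite
  HomogeneousLocalization

namespace Literature.AlgebraicGeometry.Resolution

universe u

/-! ## Principal charts: definition and formal properties -/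

section Defs

variable {X' X : Scheme.{u}} (π : X' ⟶ X) (I : X.IdealSheafData) (U : X.affineOpens)
  (g : Γ(X, U))

/-- An affine open `W ⊆ X'` **is a principal chart of `π` for `(U, g)`** if it lies over the
affine open `U ⊆ X` and the pulled-back section `π^*g|_W` is a nonzerodivisor generating the
inverse image ideal `(I·𝒪_{X'})(W)` (the defining property of the affine blowup algebra chart
`Spec A[I/g]`, Stacks 0804). [cite: StacksProject, Tag 0804] -/
def IsPrincipalChart (W : X'.affineOpens) : Prop :=
  ∃ h : (W : X'.Opens) ≤ π ⁻¹ᵁ (U : X.Opens),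
    π.appLE U W h g ∈ nonZeroDivisors Γ(X', W) ∧
      (I.comap π).ideal W = Ideal.span {π.appLE U W h g}

/-- **The principal chart `X'[U, g]` of `π` for `(U, g)`**: the union of all affine opens of `X'`
over `U` on which `π^*g` is a regular generator of `I·𝒪_{X'}` — for a blowing up, the chart
`D₊(gt) = Spec A[I/g]` of `Bl_I(Spec A)` transported to `X'` (`IsBlowup.blowupChart_eq_image`).
[cite: StacksProject, Tag 0804] -/
def blowupChart : X'.Opens :=
  ⨆ W : {W : X'.affineOpens // IsPrincipalChart π I U g W}, (W.1 : X'.Opens)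

variable {π I U g}

/-- A principal chart lies in `X'[U, g]`. [folklore] -/
theorem IsPrincipalChart.le_blowupChart {W : X'.affineOpens} (hW : IsPrincipalChart π I U g W) :
    (W : X'.Opens) ≤ blowupChart π I U g :=
  le_iSup (fun W : {W : X'.affineOpens // IsPrincipalChart π I U g W} => (W.1 : X'.Opens)) ⟨W, hW⟩

/-- A principal chart lies over `U`. [folklore] -/
theorem IsPrincipalChart.le_preimage {W : X'.affineOpens} (hW : IsPrincipalChart π I U g W) :
    (W : X'.Opens) ≤ π ⁻¹ᵁ (U : X.Opens) :=
  hW.1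

variable (π I U g) in
/-- `X'[U, g] ⊆ π⁻¹(U)`. [folklore] -/
theorem blowupChart_le_preimage : blowupChart π I U g ≤ π ⁻¹ᵁ (U : X.Opens) :=
  iSup_le fun W => W.2.1

/-- The points of `X'[U, g]` are those having a principal chart as a neighbourhood. [folklore] -/
theorem mem_blowupChart_iff {x : X'} :
    x ∈ blowupChart π I U g ↔ ∃ W : X'.affineOpens, IsPrincipalChart π I U g W ∧ x ∈ (W : X'.Opens) := by
  rw [blowupChart, Opens.mem_iSup]
  constructor
  · rintro ⟨W, hW⟩
    exact ⟨W.1, W.2, hW⟩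
  · rintro ⟨W, hW, hx⟩
    exact ⟨⟨W, hW⟩, hx⟩

/-- Pulling back and then restricting is pulling back to the smaller open. [folklore] -/
theorem map_appLE_eq {W : X'.Opens} {W' : X'.Opens} (h : W ≤ π ⁻¹ᵁ (U : X.Opens))
    (h' : W' ≤ W) (s : Γ(X, U)) :
    X'.presheaf.map (homOfLE h').op (π.appLE U W h s) = π.appLE U W' (h'.trans h) s := by
  rw [← CommRingCat.comp_apply, Scheme.Hom.appLE_map]

/-- **Principal charts are stable under shrinking**: an affine open inside a principal chart is a
principal chart (the generator restricts to a generator, `ideal_eq_span_map_of_le`, and stays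
regular, `map_mem_nonZeroDivisors_of_le_affine`). [folklore] -/
theorem IsPrincipalChart.of_le {W W' : X'.affineOpens} (hW : IsPrincipalChart π I U g W)
    (h' : (W' : X'.Opens) ≤ W) : IsPrincipalChart π I U g W' := by
  obtain ⟨h, hnzd, hideal⟩ := hW
  refine ⟨h'.trans h, ?_, ?_⟩
  · rw [← map_appLE_eq h h']
    exact map_mem_nonZeroDivisors_of_le_affine h' hnzd
  · rw [← map_appLE_eq h h']
    exact ideal_eq_span_map_of_le _ h' hideal

/-- Every point of `X'[U, g]` has arbitrarily small principal-chart neighbourhoods. [folklore] -/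
theorem exists_isPrincipalChart_le_of_mem {x : X'} (hx : x ∈ blowupChart π I U g) {O : X'.Opens}
    (hO : x ∈ O) : ∃ W : X'.affineOpens, IsPrincipalChart π I U g W ∧ x ∈ (W : X'.Opens) ∧
      (W : X'.Opens) ≤ O := by
  obtain ⟨W, hW, hxW⟩ := mem_blowupChart_iff.mp hx
  obtain ⟨W'', hW'', hxW'', hle⟩ := exists_isAffineOpen_mem_and_subset (X := X') (x := x)
    (U := (W : X'.Opens) ⊓ O) ⟨hxW, hO⟩
  exact ⟨⟨W'', hW''⟩, hW.of_le fun y hy => (hle hy).1, hxW'', fun y hy => (hle hy).2⟩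

/-- On a principal chart, `(I·𝒪_{X'})(W)` is the extension of `I(U)`; in particular the pull-back
of any section of `I(U)` is a multiple of `π^*g`. [folklore] -/
theorem IsPrincipalChart.exists_eq_mul {W : X'.affineOpens} (hW : IsPrincipalChart π I U g W)
    {s : Γ(X, U)} (hs : s ∈ I.ideal U) :
    ∃ c : Γ(X', W), π.appLE U W hW.le_preimage s = c * π.appLE U W hW.le_preimage g := by
  obtain ⟨h, -, hideal⟩ := hW
  have : π.appLE U W h s ∈ (I.comap π).ideal W := by
    rw [ideal_comap_of_le π I U W h]
    exact Ideal.mem_map_of_mem _ hs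
  rw [hideal] at this
  obtain ⟨c, hc⟩ := Ideal.mem_span_singleton'.mp this
  exact ⟨c, hc.symm⟩

end Defs

/-! ## The charts `D₊(bt)` of the affine blowing up: explicit generator, lifting, covering -/

section Affine

variable {R : Type u} [CommRing R] (I : Ideal R)

/-- The pull-back to an open `W` of the affine blowing up of an element `r ∈ R` (through
`Γ(Spec R, ⊤) ≅ R`). [folklore] -/
abbrev affineBlowup.pull (W : (affineBlowup I).Opens) (r : R) : Γ(affineBlowup I, W) :=
  (affineBlowup.π I).appLE ⊤ W le_top ((Scheme.ΓSpecIso (.of R)).inv r)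

variable {I}

/-- Through `Γ(Bl, D₊(bt)) ≅ Γ(Spec (R[It])_{(bt)}, ⊤) ≅ (R[It])_{(bt)}`, pulling back `R` to the
chart `D₊(bt)` is the degree-zero structure map `r ↦ r/1` (`reesChartBase`). [folklore] -/
theorem affineBlowup.ΓSpecIso_inv_appLE_appIso_hom (b : R) (hb : b ∈ I) :
    (Scheme.ΓSpecIso (.of R)).inv ≫ (affineBlowup.π I).appLE ⊤ (affineBlowup.chartOpen b hb) le_top ≫
        ((affineBlowup.chartι (I := I) b hb).appIso ⊤).hom =
      CommRingCat.ofHom (reesChartBase b hb) ≫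
        (Scheme.ΓSpecIso (.of (Away (reesGrading I) (reesT b hb)))).inv := by
  have h1 : ((affineBlowup.chartι (I := I) b hb).appIso ⊤).hom =
      (affineBlowup.chartι (I := I) b hb).appLE (affineBlowup.chartOpen b hb) ⊤
        (Scheme.Hom.preimage_image_eq _ _).ge :=
    Scheme.Hom.appIso_hom' _ _
  rw [h1, Scheme.Hom.appLE_comp_appLE, affineBlowup.chartι_π]
  have h2 : ∀ e, (Spec.map (CommRingCat.ofHom (reesChartBase (I := I) b hb))).appLE ⊤ ⊤ e =
      (Spec.map (CommRingCat.ofHom (reesChartBase (I := I) b hb))).appTop := by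
    intro e
    rw [Scheme.Hom.appTop, Scheme.Hom.app_eq_appLE]
    rfl
  rw [h2, ← Scheme.ΓSpecIso_inv_naturality]

/-- Pointwise form: the pull-back of `r ∈ R` to `D₊(bt)` is `r/1` through the chart
isomorphisms. [folklore] -/
theorem affineBlowup.appIso_hom_pull (b : R) (hb : b ∈ I) (r : R) :
    ((affineBlowup.chartι (I := I) b hb).appIso ⊤).hom (affineBlowup.pull I (affineBlowup.chartOpen b hb) r) =
      (Scheme.ΓSpecIso (.of (Away (reesGrading I) (reesT b hb)))).inv (reesChartBase b hb r) := by
  have := congrArg (fun f : CommRingCat.of R ⟶ _ => f r)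
    (affineBlowup.ΓSpecIso_inv_appLE_appIso_hom (I := I) b hb)
  exact this

/-- **On the chart `D₊(bt)` the exceptional ideal is generated by the image of `b`** (Stacks 02OS,
proof: the restriction of `E` to `Spec A[I/a]` corresponds to the ideal generated by the image of
`a`), explicit form of `affineBlowup.exceptionalIdeal_chartOpen`. [cite: StacksProject, Tag 02OS (proof, via Tag 07Z3)] -/
theorem affineBlowup.ideal_exceptionalIdeal_chartOpen (b : R) (hb : b ∈ I) :
    (affineBlowup.exceptionalIdeal I).ideal (affineBlowup.chartOpen b hb) =
      Ideal.span {affineBlowup.pull I (affineBlowup.chartOpen b hb) b} := by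
  let B := Away (reesGrading I) (reesT b hb)
  let j := affineBlowup.chartι (I := I) b hb
  let K := affineBlowup.exceptionalIdeal I
  let ε : Γ(Spec (.of B), ⊤) ≅ CommRingCat.of B := Scheme.ΓSpecIso (.of B)
  let g₀ : Γ(Spec (.of B), ⊤) := ε.inv.hom (reesChartBase b hb b)
  have h2 : (K.comap j).ideal ⟨⊤, isAffineOpen_top _⟩ = Ideal.span {g₀} := by
    rw [affineBlowup.exceptionalIdeal_comap_chartι, ideal_ofIdealTop_top, map_reesChartBase_eq,
      Ideal.map_span, Set.image_singleton]
  let e : Γ(affineBlowup I, affineBlowup.chartOpen (I := I) b hb) ≃+* Γ(Spec (.of B), ⊤) :=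
    (j.appIso ⊤).commRingCatIsoToRingEquiv
  have h3 : ((K.ideal (affineBlowup.chartOpen b hb)).comap e.symm.toRingHom) = Ideal.span {g₀} := by
    rw [← h2]
    exact (Scheme.IdealSheafData.ideal_comap_of_isOpenImmersion K j ⟨⊤, isAffineOpen_top _⟩).symm
  have h4 : e (affineBlowup.pull I (affineBlowup.chartOpen b hb) b) = g₀ :=
    affineBlowup.appIso_hom_pull b hb b
  have : K.ideal (affineBlowup.chartOpen b hb) =
      ((K.ideal (affineBlowup.chartOpen b hb)).comap e.symm.toRingHom).comap e.toRingHom := by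
    rw [Ideal.comap_comap]
    convert (Ideal.comap_id _).symm
    ext a
    exact e.symm_apply_apply a
  rw [this, h3, comap_span_singleton_ringEquiv e g₀, ← h4]
  exact congrArg _ (congrArg _ (e.symm_apply_apply _))

/-- On the chart `D₊(bt)` the image of `b` is a nonzerodivisor (Stacks 02OS, proof: "the image of
`a` in `A[I/a]` is a nonzerodivisor"). [cite: StacksProject, Tag 02OS (proof, via Tag 07Z3)] -/
theorem affineBlowup.pull_mem_nonZeroDivisors (b : R) (hb : b ∈ I) :
    affineBlowup.pull I (affineBlowup.chartOpen b hb) b ∈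
      nonZeroDivisors Γ(affineBlowup I, affineBlowup.chartOpen (I := I) b hb) := by
  let B := Away (reesGrading I) (reesT b hb)
  let ε : Γ(Spec (.of B), ⊤) ≅ CommRingCat.of B := Scheme.ΓSpecIso (.of B)
  have hφ : reesChartBase b hb b ∈ nonZeroDivisors B := reesChartBase_mem_nonZeroDivisors b hb
  have hg₀ : ε.inv.hom (reesChartBase b hb b) ∈ nonZeroDivisors _ :=
    mem_nonZeroDivisors_of_inverse ε.inv.hom ε.hom.hom (fun a => by
      change (ε.inv ≫ ε.hom).hom a = a; rw [ε.inv_hom_id]; rfl) (fun a => by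
      change (ε.hom ≫ ε.inv).hom a = a; rw [ε.hom_inv_id]; rfl) hφ
  let e : Γ(affineBlowup I, affineBlowup.chartOpen (I := I) b hb) ≃+* Γ(Spec (.of B), ⊤) :=
    ((affineBlowup.chartι (I := I) b hb).appIso ⊤).commRingCatIsoToRingEquiv
  have h4 : e (affineBlowup.pull I (affineBlowup.chartOpen b hb) b) =
      ε.inv.hom (reesChartBase b hb b) :=
    affineBlowup.appIso_hom_pull b hb b
  have : affineBlowup.pull I (affineBlowup.chartOpen b hb) b =
      e.symm (ε.inv.hom (reesChartBase b hb b)) := by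
    rw [← h4, e.symm_apply_apply]
  rw [this]
  exact mem_nonZeroDivisors_of_inverse e.symm.toRingHom e.toRingHom
    (fun a => e.apply_symm_apply a) (fun a => e.symm_apply_apply a) hg₀

/-- **Lifting into a chart** (Görtz–Wedhorn I, proof of Prop. 13.92, p. 415: a morphism
`q : T → Spec A` along which `I·𝒪_T` is generated by the regular image `u` of an element `b ∈ I`
factors through the chart `D₊(bt) = Spec A[I/b]`): the morphism `T → Bl_I(Spec R)` over `q` given
by the ring homomorphism `R[It] → Γ(T, 𝒪_T)`, `x tⁿ ↦ q^*(x)/uⁿ` (`exists_ringHom_reesAlgebra`,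
Mathlib's `Proj.fromOfGlobalSections`) has `D₊(bt)` pulling back to `T_{q^*(b)/u} = T_1 = T`.
[cite: GortzWedhorn2020, Prop. 13.92 (proof, p. 415)] -/
theorem affineBlowup.exists_lift_preimage_basicOpen_eq_top {T : Scheme.{u}}
    (q : T ⟶ Spec (.of R)) {u : Γ(T, ⊤)} (hu : u ∈ nonZeroDivisors Γ(T, ⊤))
    (hIu : I.map (q.appTop.hom.comp (Scheme.ΓSpecIso (.of R)).inv.hom) = Ideal.span {u})
    (b : R) (hb : b ∈ I) (hbu : q.appTop.hom ((Scheme.ΓSpecIso (.of R)).inv.hom b) = u) :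
    ∃ l : T ⟶ affineBlowup I, l ≫ affineBlowup.π I = q ∧
      l ⁻¹ᵁ Proj.basicOpen (reesGrading I) (reesT b hb) = ⊤ := by
  obtain ⟨ψ, hψ, hψt, hirr⟩ := exists_ringHom_reesAlgebra hu hIu
  refine ⟨Proj.fromOfGlobalSections (reesGrading I) ψ hirr, ?_, ?_⟩
  · rw [affineBlowup.π, ← Category.assoc, Proj.fromOfGlobalSections_toSpecZero, Category.assoc,
      ← Spec.map_comp]
    conv_rhs => rw [eq_toSpecΓ_SpecMap q]
    congr 2
    ext r
    change ψ (algebraMap R (reesAlgebra I) r) = q.appTop.hom ((Scheme.ΓSpecIso (.of R)).inv.hom r)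
    rw [hψ]
    rfl
  · rw [Proj.fromOfGlobalSections_preimage_basicOpen (reesGrading I) ψ hirr one_pos (reesT_mem b hb)]
    -- `ψ (b t) · u = q^*(b) = u`, so `ψ (b t) = 1`
    have h1 : ψ (reesT b hb) = 1 := by
      have h := hψt b hb
      rw [RingHom.comp_apply] at h
      change ψ (reesT b hb) * u = q.appTop.hom ((Scheme.ΓSpecIso (.of R)).inv.hom b) at h
      rw [hbu] at h
      have h' : (ψ (reesT b hb) - 1) * u = 0 := by rw [sub_mul, one_mul, h, sub_self]
      exact sub_eq_zero.mp (mem_nonZeroDivisors_iff_right.mp hu _ h')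
    rw [h1]
    exact T.basicOpen_of_isUnit isUnit_one

/-- `c t` lies in the ideal generated by the `x_k t` when `c ∈ I = (x_k)_k`. [folklore] -/
theorem reesT_mem_span_range_reesT_of_span_eq {κ : Type*} (x : κ → R)
    (hx : Ideal.span (Set.range x) = I) (c : R) (hc : c ∈ I) :
    reesT c hc ∈ Ideal.span (Set.range fun k : κ =>
      reesT (I := I) (x k) (hx ▸ Ideal.subset_span (Set.mem_range_self k))) := by
  classical
  have hc' : c ∈ Ideal.span (Set.range x) := hx ▸ hc
  obtain ⟨f, hf⟩ := (Finsupp.mem_span_range_iff_exists_finsupp (R := R) (v := x) (x := c)).mp hc'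
  have key : reesT c hc = f.sum fun k a => algebraMap R (reesAlgebra I) a *
      reesT (I := I) (x k) (hx ▸ Ideal.subset_span (Set.mem_range_self k)) := by
    apply Subtype.ext
    rw [Finsupp.sum, AddSubmonoidClass.coe_finsetSum]
    simp only [coe_reesT, Subalgebra.coe_mul, Subalgebra.coe_algebraMap,
      ← Polynomial.C_eq_algebraMap, Polynomial.C_mul_monomial]
    rw [← map_sum (Polynomial.monomial 1)]
    congr 1
    rw [← hf, Finsupp.sum]
    simp only [smul_eq_mul]
  rw [key, Finsupp.sum]
  exact Ideal.sum_mem _ fun k _ => Ideal.mul_mem_left _ _ (Ideal.subset_span ⟨k, rfl⟩)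

/-- **The charts `D₊(x_k t)` at a family of generators `(x_k)` of `I` cover `Bl_I(Spec R)`**: the
irrelevant ideal `R[It]₊` is generated by the `x_k t` (Stacks 0804). [cite: StacksProject, Tag 0804] -/
theorem affineBlowup.iSup_chartOpen_eq_top {κ : Type*} (x : κ → R)
    (hx : Ideal.span (Set.range x) = I) :
    ⨆ k, (affineBlowup.chartOpen (I := I) (x k)
      (hx ▸ Ideal.subset_span (Set.mem_range_self k)) : (affineBlowup I).Opens) = ⊤ := by
  have : ∀ k, (affineBlowup.chartOpen (I := I) (x k)
      (hx ▸ Ideal.subset_span (Set.mem_range_self k)) : (affineBlowup I).Opens) =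
      Proj.basicOpen (reesGrading I) (reesT (x k) (hx ▸ Ideal.subset_span (Set.mem_range_self k))) :=
    fun k => affineBlowup.image_top_chartι _ _
  simp_rw [this]
  refine Proj.iSup_basicOpen_eq_top (reesGrading I) _ ((irrelevant_le_span_reesT I).trans ?_)
  rw [Ideal.span_le]
  rintro _ ⟨c, rfl⟩
  exact reesT_mem_span_range_reesT_of_span_eq x hx c.1 c.2

end Affine

/-! ## Comparison with the affine blowing up over an affine open of the base -/

section Compare

variable {X' X : Scheme.{u}} {π : X' ⟶ X} {I : X.IdealSheafData}

/-- `appLE` along equal morphisms. [folklore] -/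
theorem appLE_congr_hom {f f' : X' ⟶ X} (e : f = f') (V : X.Opens) (W : X'.Opens)
    (h : W ≤ f ⁻¹ᵁ V) : f.appLE V W h = f'.appLE V W (e ▸ h) := by
  subst e
  rfl

/-- For an affine open `U`, pulling back along `Spec Γ(X, U) → X` to the top open is the
canonical isomorphism `Γ(X, U) ≅ Γ(Spec Γ(X, U), ⊤)`. [folklore] -/
theorem fromSpec_appLE_top (U : X.affineOpens)
    (e : (⊤ : (Spec Γ(X, U)).Opens) ≤ U.2.fromSpec ⁻¹ᵁ (U : X.Opens)) :
    U.2.fromSpec.appLE U ⊤ e = (Scheme.ΓSpecIso Γ(X, U)).inv := by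
  rw [Scheme.Hom.appLE, U.2.fromSpec_app_of_le U le_rfl,
    show homOfLE (le_refl (U : X.Opens)) = 𝟙 _ from Subsingleton.elim _ _, op_id,
    X.presheaf.map_id, Category.id_comp, Category.assoc, ← Functor.map_comp,
    show (homOfLE (le_top : U.2.fromSpec ⁻¹ᵁ (U : X.Opens) ≤ ⊤)).op ≫ (homOfLE e).op = 𝟙 _ from
      Subsingleton.elim _ _, CategoryTheory.Functor.map_id, Category.comp_id]

/-- The restriction along `U ↪ X` to the top open is the isomorphism `Γ(X, U) ≅ Γ(U, ⊤)`.
[folklore] -/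
theorem ι_appLE_eq_topIso_inv (W : X'.Opens) (e : (⊤ : (W : Scheme.{u}).Opens) ≤ W.ι ⁻¹ᵁ W) :
    W.ι.appLE W ⊤ e = W.topIso.inv := by
  rw [Scheme.Opens.ι_appLE, Scheme.Opens.topIso_inv]
  exact congrArg X'.presheaf.map (Subsingleton.elim _ _)

/-- **The inverse image of `I` along `Spec Γ(X, U) → X` is the ideal sheaf `Ĩ(U)` of the ideal
`I(U) ⊆ Γ(X, U)`.** [folklore] -/
theorem comap_fromSpec (I : X.IdealSheafData) (U : X.affineOpens) :
    I.comap U.2.fromSpec = affineBlowup.idealSheaf (I.ideal U) := by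
  apply Scheme.IdealSheafData.ext_of_isAffine
  have e : ((⟨⊤, isAffineOpen_top _⟩ : (Spec Γ(X, U)).affineOpens) : (Spec Γ(X, U)).Opens) ≤
      U.2.fromSpec ⁻¹ᵁ (U : X.Opens) := by
    rw [U.2.fromSpec_preimage_self]
  rw [affineBlowup.idealSheaf, ideal_ofIdealTop_top, ideal_comap_of_le U.2.fromSpec I U _ e,
    fromSpec_appLE_top]
  rfl

/-- **A blowing up restricted over an affine open `U` of the base is a blowing up of
`Spec Γ(X, U)` along `Ĩ(U)`** (Görtz–Wedhorn I, Prop. 13.91 (2) for `U ↪ X`, moved along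
`U ≅ Spec Γ(X, U)`). [cite: GortzWedhorn2020, Prop. 13.91] -/
theorem IsBlowup.restrict_isoSpec (hπ : IsBlowup π I) (U : X.affineOpens) :
    IsBlowup ((π ∣_ (U : X.Opens)) ≫ U.2.isoSpec.hom) (affineBlowup.idealSheaf (I.ideal U)) := by
  have h := (hπ.restrict U).comp_iso U.2.isoSpec
  rwa [← Scheme.IdealSheafData.comap_comp, IsAffineOpen.isoSpec_inv_ι, comap_fromSpec] at h

/-- **The chart immersion**: for a blowing up `π : X' → X` and an affine open `U ⊆ X` there is an
open immersion `Bl_{I(U)}(Spec Γ(X, U)) → X'` over `U` with image `π⁻¹(U)` (uniqueness of blowing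
ups applied to `π|_{π⁻¹(U)}` and the affine construction, Görtz–Wedhorn I, Prop. 13.92).
[cite: GortzWedhorn2020, Prop. 13.92] -/
theorem IsBlowup.exists_chartImmersion (hπ : IsBlowup π I) (U : X.affineOpens) :
    ∃ (φ : affineBlowup (I.ideal U) ⟶ X') (_ : IsOpenImmersion φ),
      φ ≫ π = affineBlowup.π (I.ideal U) ≫ U.2.fromSpec ∧ φ.opensRange = π ⁻¹ᵁ (U : X.Opens) := by
  obtain ⟨e, he, -⟩ := (affineBlowup.isBlowup (I.ideal U)).unique (hπ.restrict_isoSpec U)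
  refine ⟨e.hom ≫ (π ⁻¹ᵁ (U : X.Opens)).ι, inferInstance, ?_, ?_⟩
  · rw [Category.assoc, ← morphismRestrict_ι, ← U.2.isoSpec_hom_fromSpec, reassoc_of% he]
  · rw [Scheme.Hom.opensRange_comp_of_isIso, Scheme.Opens.opensRange_ι]

variable (hπ : IsBlowup π I) {U : X.affineOpens} (φ : affineBlowup (I.ideal U) ⟶ X')
  [IsOpenImmersion φ] (hφ : φ ≫ π = affineBlowup.π (I.ideal U) ≫ U.2.fromSpec)
  (hrange : φ.opensRange = π ⁻¹ᵁ (U : X.Opens))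

include hφ in
omit [IsOpenImmersion φ] in
/-- Along the chart immersion the inverse image ideal of `I` pulls back to the exceptional ideal
of `Bl_{I(U)}(Spec Γ(X, U))`. [folklore] -/
theorem comap_comap_chartImmersion :
    (I.comap π).comap φ = affineBlowup.exceptionalIdeal (I.ideal U) := by
  rw [← Scheme.IdealSheafData.comap_comp, hφ, Scheme.IdealSheafData.comap_comp, comap_fromSpec]
  rfl

include hφ in
/-- Through `Γ(X', φ(D₊(bt))) ≅ Γ(Bl, D₊(bt))`, the pull-back `π^*b` corresponds to the pull-back of
`b` to the chart. [folklore] -/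
theorem appIso_hom_appLE_chartImmersion (b : Γ(X, U)) (hb : b ∈ I.ideal U)
    (h : φ ''ᵁ (affineBlowup.chartOpen b hb : (affineBlowup (I.ideal U)).Opens) ≤
      π ⁻¹ᵁ (U : X.Opens)) (s : Γ(X, U)) :
    (φ.appIso (affineBlowup.chartOpen b hb)).hom (π.appLE U _ h s) =
      affineBlowup.pull (I.ideal U) (affineBlowup.chartOpen b hb) s := by
  rw [Scheme.Hom.appIso_hom', ← CommRingCat.comp_apply, Scheme.Hom.appLE_comp_appLE,
    appLE_congr_hom hφ]
  have key : ∀ e', (affineBlowup.π (I.ideal U) ≫ U.2.fromSpec).appLE U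
      (affineBlowup.chartOpen b hb) e' = U.2.fromSpec.appLE U ⊤
        (by rw [U.2.fromSpec_preimage_self]) ≫
          (affineBlowup.π (I.ideal U)).appLE ⊤ (affineBlowup.chartOpen b hb) le_top := by
    intro e'
    rw [Scheme.Hom.appLE_comp_appLE]
  rw [key, fromSpec_appLE_top]
  rfl

include hφ hrange in
/-- **The image `φ(D₊(bt))` of a chart of the affine blowing up is a principal chart of `π` for
`(U, b)`**: on it `I·𝒪_{X'}` is generated by the nonzerodivisor `π^*b` (transport of
`affineBlowup.ideal_exceptionalIdeal_chartOpen`, Stacks 02OS). [cite: StacksProject, Tag 02OS (proof, via Tag 07Z3)] -/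
theorem isPrincipalChart_image_chartOpen (b : Γ(X, U)) (hb : b ∈ I.ideal U) :
    IsPrincipalChart π I U b ⟨φ ''ᵁ affineBlowup.chartOpen b hb,
      (affineBlowup.chartOpen b hb).2.image_of_isOpenImmersion φ⟩ := by
  let W₀ := affineBlowup.chartOpen (I := I.ideal U) b hb
  have h : φ ''ᵁ (W₀ : (affineBlowup (I.ideal U)).Opens) ≤ π ⁻¹ᵁ (U : X.Opens) := by
    rw [← hrange]
    exact φ.image_le_opensRange _
  let e : Γ(X', φ ''ᵁ (W₀ : (affineBlowup (I.ideal U)).Opens)) ≃+*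
      Γ(affineBlowup (I.ideal U), W₀) := (φ.appIso W₀).commRingCatIsoToRingEquiv
  have he : e (π.appLE U _ h b) = affineBlowup.pull (I.ideal U) W₀ b :=
    appIso_hom_appLE_chartImmersion φ hφ b hb h b
  have he' : π.appLE U _ h b = e.symm (affineBlowup.pull (I.ideal U) W₀ b) := by
    rw [← he, e.symm_apply_apply]
  refine ⟨h, ?_, ?_⟩
  · rw [he']
    exact mem_nonZeroDivisors_of_inverse e.symm.toRingHom e.toRingHom
      (fun a => e.apply_symm_apply a) (fun a => e.symm_apply_apply a)
      (affineBlowup.pull_mem_nonZeroDivisors b hb)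
  · have h3 : (((I.comap π).ideal ⟨φ ''ᵁ (W₀ : (affineBlowup (I.ideal U)).Opens),
        W₀.2.image_of_isOpenImmersion φ⟩).comap e.symm.toRingHom) =
        Ideal.span {affineBlowup.pull (I.ideal U) W₀ b} := by
      rw [← affineBlowup.ideal_exceptionalIdeal_chartOpen b hb,
        ← comap_comap_chartImmersion φ hφ]
      exact (Scheme.IdealSheafData.ideal_comap_of_isOpenImmersion (I.comap π) φ W₀).symm
    have : (I.comap π).ideal ⟨φ ''ᵁ (W₀ : (affineBlowup (I.ideal U)).Opens),
        W₀.2.image_of_isOpenImmersion φ⟩ = (((I.comap π).ideal ⟨φ ''ᵁ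
          (W₀ : (affineBlowup (I.ideal U)).Opens), W₀.2.image_of_isOpenImmersion φ⟩).comap
            e.symm.toRingHom).comap e.toRingHom := by
      rw [Ideal.comap_comap]
      convert (Ideal.comap_id _).symm
      ext a
      exact e.symm_apply_apply a
    rw [this, h3, comap_span_singleton_ringEquiv e, ← he']

include hπ hφ hrange in
/-- **The principal chart `X'[U, b]` is the image of the chart `D₊(bt)` of
`Bl_{I(U)}(Spec Γ(X, U))`.** The image is a principal chart
(`isPrincipalChart_image_chartOpen`); conversely a principal chart `W` maps to the affine blowing
up by the lift of `W ↪ X'`, and also by the chart lift INTO `D₊(bt)`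
(`affineBlowup.exists_lift_preimage_basicOpen_eq_top`, as `π^*b` is a regular generator on `W`);
the two agree by the uniqueness of morphisms to a blowing up, so `W ⊆ φ(D₊(bt))`.
[cite: GortzWedhorn2020, Prop. 13.92 (proof, p. 415)] -/
theorem IsBlowup.blowupChart_eq_image (b : Γ(X, U)) (hb : b ∈ I.ideal U) :
    blowupChart π I U b = φ ''ᵁ affineBlowup.chartOpen b hb := by
  refine le_antisymm (iSup_le fun W => ?_) (isPrincipalChart_image_chartOpen φ hφ hrange b hb).le_blowupChart
  obtain ⟨W, h, hnzd, hideal⟩ := W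
  -- notation
  let I₀ := I.ideal U
  let p := affineBlowup.π I₀
  let W₀ := affineBlowup.chartOpen (I := I₀) b hb
  haveI : IsAffine (W : Scheme.{u}) := W.2
  -- the lift `w : W → Bl` of `W ↪ X'` through `φ`
  have hWr : Set.range (W : X'.Opens).ι ⊆ Set.range φ := by
    rw [Scheme.Opens.range_ι, ← Scheme.Hom.coe_opensRange, hrange]
    exact h
  let w := IsOpenImmersion.lift φ (W : X'.Opens).ι hWr
  have hw : w ≫ φ = (W : X'.Opens).ι := IsOpenImmersion.lift_fac _ _ _
  let q : (W : Scheme.{u}) ⟶ Spec Γ(X, U) := w ≫ p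
  have hq : q ≫ U.2.fromSpec = (W : X'.Opens).ι ≫ π := by
    change (w ≫ p) ≫ U.2.fromSpec = _
    rw [Category.assoc, ← hφ, reassoc_of% hw]
  -- the ideal sheaf of `I(U)` pulls back along `q` to `I·𝒪_{X'}|_W`, an effective Cartier divisor
  have hcomap : (affineBlowup.idealSheaf I₀).comap q = (I.comap π).comap (W : X'.Opens).ι := by
    rw [← comap_fromSpec, ← Scheme.IdealSheafData.comap_comp, hq, Scheme.IdealSheafData.comap_comp]
  have hcart : IsEffectiveCartier ((affineBlowup.idealSheaf I₀).comap q) := by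
    rw [hcomap]
    exact hπ.isEffectiveCartier.comap_ι _
  -- the regular generator `u = π^*b|_W` of `I(U)·Γ(W, 𝒪_W)`
  let β : Γ(X', W) := π.appLE U W h b
  let t : Γ(X', W) ≅ Γ((W : X'.Opens), ⊤) := (W : X'.Opens).topIso.symm
  have htop : (⊤ : (W : Scheme.{u}).Opens) ≤ q ⁻¹ᵁ ⊤ := (Opens.map_top q.base).symm.le
  have e₁ : (⊤ : (Spec Γ(X, U)).Opens) ≤ U.2.fromSpec ⁻¹ᵁ (U : X.Opens) := by
    rw [U.2.fromSpec_preimage_self]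
  have e₃ : (⊤ : (W : Scheme.{u}).Opens) ≤ (W : X'.Opens).ι ⁻¹ᵁ (W : X'.Opens) := fun x _ => x.2
  have a1 : q.appTop = q.appLE ⊤ ⊤ htop := by
    rw [Scheme.Hom.appTop, Scheme.Hom.app_eq_appLE]
    rfl
  have e1 : (Scheme.ΓSpecIso Γ(X, U)).inv ≫ q.appTop = π.appLE U W h ≫ t.hom :=
    calc (Scheme.ΓSpecIso Γ(X, U)).inv ≫ q.appTop
        = U.2.fromSpec.appLE U ⊤ e₁ ≫ q.appLE ⊤ ⊤ htop := by rw [fromSpec_appLE_top, a1]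
      _ = (q ≫ U.2.fromSpec).appLE U ⊤ _ := Scheme.Hom.appLE_comp_appLE _ _ _ _ _ _ _
      _ = ((W : X'.Opens).ι ≫ π).appLE U ⊤ _ := appLE_congr_hom hq _ _ _
      _ = π.appLE U W h ≫ (W : X'.Opens).ι.appLE W ⊤ e₃ :=
          (Scheme.Hom.appLE_comp_appLE _ _ _ _ _ _ _).symm
      _ = π.appLE U W h ≫ t.hom := by rw [ι_appLE_eq_topIso_inv]; rfl
  have hqapp : ∀ s : Γ(X, U), q.appTop.hom ((Scheme.ΓSpecIso Γ(X, U)).inv.hom s) =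
      t.hom.hom (π.appLE U W h s) := by
    intro s
    rw [← CommRingCat.comp_apply, e1]
    rfl
  have hu : t.hom.hom β ∈ nonZeroDivisors _ :=
    mem_nonZeroDivisors_of_inverse t.hom.hom t.inv.hom (fun a => by
      rw [← CommRingCat.comp_apply, t.hom_inv_id]; rfl) (fun a => by
      rw [← CommRingCat.comp_apply, t.inv_hom_id]; rfl) hnzd
  have hIu : I₀.map (q.appTop.hom.comp (Scheme.ΓSpecIso Γ(X, U)).inv.hom) =
      Ideal.span {t.hom.hom β} := by
    have : q.appTop.hom.comp (Scheme.ΓSpecIso Γ(X, U)).inv.hom = t.hom.hom.comp (π.appLE U W h).hom :=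
      RingHom.ext hqapp
    rw [this, ← Ideal.map_map, ← ideal_comap_of_le π I U W h, hideal, Ideal.map_span,
      Set.image_singleton]
  -- the chart lift into `D₊(bt)` coincides with `w`
  obtain ⟨l, hl, hltop⟩ := affineBlowup.exists_lift_preimage_basicOpen_eq_top (I := I₀) q hu hIu
    b hb (hqapp b)
  have hlw : l = w := by
    refine (affineBlowup.isBlowup I₀).hom_ext ?_ (hl.trans rfl)
    rw [hl]
    exact hcart
  -- hence `W ⊆ φ(D₊(bt))`
  intro x hx
  have hx' : (W : X'.Opens).ι ⟨x, hx⟩ = φ (w ⟨x, hx⟩) := by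
    rw [← Scheme.Hom.comp_apply, hw]
  change x ∈ φ ''ᵁ (W₀ : (affineBlowup I₀).Opens)
  have : x = φ (w ⟨x, hx⟩) := hx'
  rw [this, Scheme.Hom.apply_mem_image_iff, ← hlw]
  have hmem : (⟨x, hx⟩ : (W : X'.Opens)) ∈ l ⁻¹ᵁ Proj.basicOpen (reesGrading I₀) (reesT b hb) := by
    rw [hltop]; trivial
  change l ⟨x, hx⟩ ∈ (affineBlowup.chartι (I := I₀) b hb) ''ᵁ ⊤
  rw [affineBlowup.image_top_chartι]
  exact hmem

/-! ## Consequences for a blowing up -/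

include hπ in
/-- **The principal charts of a blowing up are affine** (they are the charts `Spec A[I/g]`).
[cite: StacksProject, Tag 0804] -/
theorem IsBlowup.isAffineOpen_blowupChart {b : Γ(X, U)} (hb : b ∈ I.ideal U) :
    IsAffineOpen (blowupChart π I U b) := by
  obtain ⟨φ, _, hφ, hrange⟩ := hπ.exists_chartImmersion U
  rw [hπ.blowupChart_eq_image φ hφ hrange b hb]
  exact (affineBlowup.chartOpen b hb).2.image_of_isOpenImmersion φ

include hπ in
/-- **On the principal chart `X'[U, b]` of a blowing up, `I·𝒪_{X'}` is generated by the
nonzerodivisor `π^*b`** (Stacks 02OS, proof: the exceptional divisor restricted to `Spec A[I/a]`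
is cut out by the image of `a`, a nonzerodivisor). [cite: StacksProject, Tag 02OS (proof, via Tag 07Z3)] -/
theorem IsBlowup.isPrincipalChart_blowupChart {b : Γ(X, U)} (hb : b ∈ I.ideal U) :
    IsPrincipalChart π I U b ⟨blowupChart π I U b, hπ.isAffineOpen_blowupChart hb⟩ := by
  obtain ⟨φ, _, hφ, hrange⟩ := hπ.exists_chartImmersion U
  have e : (⟨blowupChart π I U b, hπ.isAffineOpen_blowupChart hb⟩ : X'.affineOpens) =
      ⟨φ ''ᵁ affineBlowup.chartOpen b hb, (affineBlowup.chartOpen b hb).2.image_of_isOpenImmersion φ⟩ :=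
    Subtype.ext (hπ.blowupChart_eq_image φ hφ hrange b hb)
  rw [e]
  exact isPrincipalChart_image_chartOpen φ hφ hrange b hb

include hπ in
/-- **The principal charts at a family of generators of `I(U)` cover `π⁻¹(U)`** (Stacks 0804:
"`b⁻¹(U)` has an affine open covering by spectra of the affine blowup algebras `A[I/a]`", the `a`
running over generators). [cite: StacksProject, Tag 0804] -/
theorem IsBlowup.iSup_blowupChart {κ : Type*} (x : κ → Γ(X, U))
    (hx : Ideal.span (Set.range x) = I.ideal U) :
    ⨆ k, blowupChart π I U (x k) = π ⁻¹ᵁ (U : X.Opens) := by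
  obtain ⟨φ, _, hφ, hrange⟩ := hπ.exists_chartImmersion U
  have hxk : ∀ k, x k ∈ I.ideal U := fun k => hx ▸ Ideal.subset_span (Set.mem_range_self k)
  have : ∀ k, blowupChart π I U (x k) = φ ''ᵁ affineBlowup.chartOpen (x k) (hxk k) := fun k =>
    hπ.blowupChart_eq_image φ hφ hrange (x k) (hxk k)
  simp_rw [this]
  rw [← Scheme.Hom.image_iSup, affineBlowup.iSup_chartOpen_eq_top x hx,
    Scheme.Hom.image_top_eq_opensRange, hrange]

end Compare

end Literature.AlgebraicGeometry.Resolution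

end
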